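import Summits.ValiantsHypothesis.ValiantsHypothesis.Theorems.KPlusLogSqLawTropicalBSingleContact
import Summits.ValiantsHypothesis.ValiantsHypothesis.Theorems.KPlusLogSqLawTropicalBDisjointDeviations

/-!
# Route «KPlusLogSqLaw», crux `TropicalB` (stmt-ValiantsHypothesis-19771) — THE CONTACT STRETCH OF TWO SINGLE-TOKEN ACTIVATIONS:
# nonempty, with a triple column, entered at a UNIQUE column, and left for good

HONEST FRAMING.  Helper toward the registered stubs `stub_tropThin` / `stub_tropFat` of `Cruxes/TropicalB/Lines/birth.lean` (crux
`Summit.ValiantsHypothesis.ValiantsHypothesis.Theses.KPlusLogSqLaw.TropicalB`, item stmt-ValiantsHypothesis-19771, route KPlusLogSqLaw;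
cell `pub-symmetroid`, seat val-sym-trop-p5 g26, refuter-adjacent lane, 2026-08-29; `--supports … --as helper`).  STRUCTURE laws about
unique optima (`IsDominant`) of an ARBITRARY dominance design; nothing here bounds `TropicalB`, and nothing bears on `WeakLifting`,
DoorA26 / DoorA34, `MatrixDescartes` (stmt-ValiantsHypothesis-18050) or VP ≠ VNP.

SETTING.  `B` a unique optimum, `P`, `Q` single-token activations over `B` (token columns `eP`, `eQ`).  A column is COMMON if both `P` and
`Q` deviate from `B` there, SHARED if moreover `P` and `Q` carry the same cell there (then both exchange cycles continue to the same
column, `shared_succ`), TRIPLE if the three cells are pairwise distinct; by the single-contact law (`…TropicalBSingleContact`) there is at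
most one triple column.  This file turns that count into the STRETCH STRUCTURE of the contact:
* `contact_nonempty` — the two cycles meet (the sunflower law at the base term: `LongRangeAtom.straddle`, …TropicalBDisjointDeviations);
* `exists_triple` — if a third activation `R` misses the contact, the contact has a triple column (else it is closed under the joint
  successor, hence all of `P`'s cycle, which meets `R`);
* `entry_unique` — two common columns that are NOT joint successors of shared columns coincide (the shared columns map injectively into
  the common columns missing both, and all but at most one common column is shared): THE CONTACT IS ENTERED AT ONE COLUMN, along either
  cycle;
* `first_hit` — from a column of `P`'s cycle outside the contact, the first common column met is such an entry column;
* `tail_avoids` — after the cycle of `P` has left the contact it does not re-enter before returning to the entry column;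
* `entry_symm`, `cycle_total` — bookkeeping (the entry condition read from `Q`'s side; the valuation gain of an activation summed over
  its cycle).
Located beforehand (HOME/val-sym-trop-p5/g26/exp/hub_check.py on the cell's seven cube chains): the contact of every one of 136
concentrated pairs is one run of shared columns followed by the triple column.

[this cell; folklore ingredients]
-/

set_option linter.dupNamespace false
set_option autoImplicit false

namespace Summit.ValiantsHypothesis.ValiantsHypothesis.Theorems.KPlusLogSqLaw

namespace SingleContact

/-! ## 8. The contact of two activations: it is nonempty, it has a triple column unless it is a whole cycle, its entry column is unique -/

section Contact

open Summit.ValiantsHypothesis.ValiantsHypothesis.Theorems.MatrixDescartes.Negative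
open Summit.ValiantsHypothesis.ValiantsHypothesis.Theorems.LacunarySymmetroidMatrixDescartes
open Finset

variable {m K : ℕ} (d : Fin K → ℕ) (v ε : Fin m → Fin m → Fin K → ℤ)

/-- **two single-token activations over a common base meet** (the sunflower law at the base term, via `LongRangeAtom.straddle`). [this cell] -/
theorem contact_nonempty {θB θP θQ : ℤ} {B P Q : Equiv.Perm (Fin m) × (Fin m → Fin K)}
    (hB : IsDominant d v ε θB B) (hP : IsDominant d v ε θP P) (hQ : IsDominant d v ε θQ Q) (eP eQ : Fin m)
    (hcP : ∀ i, i ≠ eP → d (P.2 i) = d (B.2 i)) (hcQ : ∀ i, i ≠ eQ → d (Q.2 i) = d (B.2 i))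
    (hδP : d (B.2 eP) < d (P.2 eP)) (hδQ : d (B.2 eQ) < d (Q.2 eQ)) :
    ∃ c, ¬ (P.1 c = B.1 c ∧ P.2 c = B.2 c) ∧ ¬ (Q.1 c = B.1 c ∧ Q.2 c = B.2 c) := by
  by_contra hcon
  have h : ∀ c, ¬ (P.1 c = B.1 c ∧ P.2 c = B.2 c) → (Q.1 c = B.1 c ∧ Q.2 c = B.2 c) := by
    intro c hc
    by_contra hq
    exact hcon ⟨c, hc, hq⟩
  have hθP := theta_lt_of_slope_lt d v ε hB hP (slope_lt_of_concentrated d eP hcP hδP)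
  have hθQ := theta_lt_of_slope_lt d v ε hB hQ (slope_lt_of_concentrated d eQ hcQ hδQ)
  have hPB : P ≠ B := fun hh => dev_token d eP hδP (by rw [hh]; exact ⟨rfl, rfl⟩)
  have hBQ : B ≠ Q := fun hh => dev_token d eQ hδQ (by rw [hh]; exact ⟨rfl, rfl⟩)
  have hdisj : ∀ b, (P.1 b ≠ B.1 b ∨ P.2 b ≠ B.2 b) → ¬ (B.1 b ≠ Q.1 b ∨ B.2 b ≠ Q.2 b) := by
    intro b hb hq
    have hb' : ¬ (P.1 b = B.1 b ∧ P.2 b = B.2 b) := fun hh => by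
      rcases hb with h1 | h1
      · exact h1 hh.1
      · exact h1 hh.2
    have := h b hb'
    rcases hq with h1 | h1
    · exact h1 this.1.symm
    · exact h1 this.2.symm
  rcases LongRangeAtom.straddle d v ε hP hB hQ hPB hBQ hdisj with ⟨h1, -⟩ | ⟨h1, -⟩
  · exact lt_asymm h1 hθP
  · exact lt_asymm h1 hθQ

/-- a SHARED column (same cell in `P` and `Q`, deviating from `B`) is followed by a common column along both cycles. [elementary] -/
theorem shared_succ {B P Q : Equiv.Perm (Fin m) × (Fin m → Fin K)} {c : Fin m}
    (hc : ¬ (P.1 c = B.1 c ∧ P.2 c = B.2 c)) (hs : P.1 c = Q.1 c ∧ P.2 c = Q.2 c) :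
    B.1.symm (Q.1 c) = B.1.symm (P.1 c) ∧
    ¬ (P.1 (B.1.symm (P.1 c)) = B.1 (B.1.symm (P.1 c)) ∧ P.2 (B.1.symm (P.1 c)) = B.2 (B.1.symm (P.1 c))) ∧
    ¬ (Q.1 (B.1.symm (P.1 c)) = B.1 (B.1.symm (P.1 c)) ∧ Q.2 (B.1.symm (P.1 c)) = B.2 (B.1.symm (P.1 c))) := by
  have hcQ : ¬ (Q.1 c = B.1 c ∧ Q.2 c = B.2 c) := fun h => hc ⟨hs.1.trans h.1, hs.2.trans h.2⟩
  refine ⟨by rw [hs.1], dev_step hc, ?_⟩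
  have := dev_step (B := B) (P := Q) hcQ
  rwa [← hs.1] at this

/-- **the contact has a triple column unless the third activation meets it**: if no column deviates in all of `P, Q, R`, the contact of
`P` and `Q` contains a column at which `P ≠ Q` (otherwise it would be closed under the joint successor, hence the whole cycle of `P`,
which meets `R`). [this cell] -/
theorem exists_triple {θB θP θQ θR : ℤ} {B P Q R : Equiv.Perm (Fin m) × (Fin m → Fin K)}
    (hB : IsDominant d v ε θB B) (hP : IsDominant d v ε θP P) (hQ : IsDominant d v ε θQ Q) (hR : IsDominant d v ε θR R)
    (eP eQ eR : Fin m)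
    (hcP : ∀ i, i ≠ eP → d (P.2 i) = d (B.2 i)) (hcQ : ∀ i, i ≠ eQ → d (Q.2 i) = d (B.2 i))
    (hcR : ∀ i, i ≠ eR → d (R.2 i) = d (B.2 i))
    (hδP : d (B.2 eP) < d (P.2 eP)) (hδQ : d (B.2 eQ) < d (Q.2 eQ)) (hδR : d (B.2 eR) < d (R.2 eR))
    (H : ∀ c, ¬ (¬ (P.1 c = B.1 c ∧ P.2 c = B.2 c) ∧ ¬ (Q.1 c = B.1 c ∧ Q.2 c = B.2 c) ∧ ¬ (R.1 c = B.1 c ∧ R.2 c = B.2 c))) :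
    ∃ c, ¬ (P.1 c = B.1 c ∧ P.2 c = B.2 c) ∧ ¬ (Q.1 c = B.1 c ∧ Q.2 c = B.2 c) ∧ ¬ (P.1 c = Q.1 c ∧ P.2 c = Q.2 c) := by
  classical
  obtain ⟨c₁, h₁P, h₁Q⟩ := contact_nonempty d v ε hB hP hQ eP eQ hcP hcQ hδP hδQ
  by_contra hcon
  have hall : ∀ c, ¬ (P.1 c = B.1 c ∧ P.2 c = B.2 c) → ¬ (Q.1 c = B.1 c ∧ Q.2 c = B.2 c) → (P.1 c = Q.1 c ∧ P.2 c = Q.2 c) := by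
    intro c h1 h2
    by_contra h3
    exact hcon ⟨c, h1, h2, h3⟩
  -- every column of the cycle of `P` through `c₁` deviates in `Q`
  have hind : ∀ t, ¬ (Q.1 (((B.1⁻¹ * P.1) ^ t) c₁) = B.1 (((B.1⁻¹ * P.1) ^ t) c₁) ∧
      Q.2 (((B.1⁻¹ * P.1) ^ t) c₁) = B.2 (((B.1⁻¹ * P.1) ^ t) c₁)) := by
    intro t
    induction t with
    | zero => simpa using h₁Q
    | succ t ih =>
      have hdP := coord_dev (B := B) (P := P) h₁P t
      have hsh := hall _ hdP ih
      rw [pow_succ_apply]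
      exact (shared_succ hdP hsh).2.2
  obtain ⟨g, hgR, hgP⟩ := contact_nonempty d v ε hB hR hP eR eP hcR hcP hδR hδP
  obtain ⟨t, -, hgt⟩ := coord_exists d v ε hB hP eP hcP hδP h₁P hgP
  exact H g ⟨hgP, hgt ▸ hind t, hgR⟩

/-- **UNIQUENESS OF THE ENTRY COLUMN** (counting corollary of the single-contact law): two common columns of `P` and `Q` that are both NOT
the joint successor of a shared column coincide — the shared columns map injectively into the common columns, missing both, while all but at
most one common column is shared. [this cell] -/
theorem entry_unique {θB θP θQ : ℤ} {B P Q : Equiv.Perm (Fin m) × (Fin m → Fin K)}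
    (hB : IsDominant d v ε θB B) (hP : IsDominant d v ε θP P) (hQ : IsDominant d v ε θQ Q) (eP eQ : Fin m)
    (hcP : ∀ i, i ≠ eP → d (P.2 i) = d (B.2 i)) (hcQ : ∀ i, i ≠ eQ → d (Q.2 i) = d (B.2 i))
    (hδP : d (B.2 eP) < d (P.2 eP)) (hδQ : d (B.2 eQ) < d (Q.2 eQ)) {c' c'' : Fin m}
    (h'P : ¬ (P.1 c' = B.1 c' ∧ P.2 c' = B.2 c')) (h'Q : ¬ (Q.1 c' = B.1 c' ∧ Q.2 c' = B.2 c'))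
    (h''P : ¬ (P.1 c'' = B.1 c'' ∧ P.2 c'' = B.2 c'')) (h''Q : ¬ (Q.1 c'' = B.1 c'' ∧ Q.2 c'' = B.2 c''))
    (h' : ∀ w, ¬ (P.1 w = B.1 w ∧ P.2 w = B.2 w) → (P.1 w = Q.1 w ∧ P.2 w = Q.2 w) → B.1.symm (P.1 w) ≠ c')
    (h'' : ∀ w, ¬ (P.1 w = B.1 w ∧ P.2 w = B.2 w) → (P.1 w = Q.1 w ∧ P.2 w = Q.2 w) → B.1.symm (P.1 w) ≠ c'') : c' = c'' := by
  classical
  by_contra hne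
  set Γ : Finset (Fin m) := univ.filter fun c => ¬ (P.1 c = B.1 c ∧ P.2 c = B.2 c) ∧ ¬ (Q.1 c = B.1 c ∧ Q.2 c = B.2 c) with hΓ
  set Sh : Finset (Fin m) := univ.filter fun c => ¬ (P.1 c = B.1 c ∧ P.2 c = B.2 c) ∧ (P.1 c = Q.1 c ∧ P.2 c = Q.2 c) with hSh
  set Tr : Finset (Fin m) := univ.filter fun c => ¬ (P.1 c = B.1 c ∧ P.2 c = B.2 c) ∧ ¬ (Q.1 c = B.1 c ∧ Q.2 c = B.2 c) ∧
    ¬ (P.1 c = Q.1 c ∧ P.2 c = Q.2 c) with hTr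
  have hc'Γ : c' ∈ Γ := by simp only [hΓ, mem_filter, mem_univ, true_and]; exact ⟨h'P, h'Q⟩
  have hc''Γ : c'' ∈ (Γ.erase c') := by
    rw [mem_erase]; refine ⟨Ne.symm hne, ?_⟩; simp only [hΓ, mem_filter, mem_univ, true_and]; exact ⟨h''P, h''Q⟩
  -- the shared columns map injectively into `Γ ∖ {c', c''}`
  have h1 : Sh.card ≤ ((Γ.erase c').erase c'').card := by
    refine Finset.card_le_card_of_injOn (fun w => B.1.symm (P.1 w)) (fun w hw => ?_) (fun w₁ _ w₂ _ h => ?_)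
    · simp only [hSh, coe_filter, mem_univ, true_and, Set.mem_setOf_eq] at hw
      rw [mem_coe, mem_erase, mem_erase]
      refine ⟨h'' w hw.1 hw.2, h' w hw.1 hw.2, ?_⟩
      simp only [hΓ, mem_filter, mem_univ, true_and]
      exact ⟨(shared_succ hw.1 hw.2).2.1, (shared_succ hw.1 hw.2).2.2⟩
    · exact P.1.injective (B.1.symm.injective h)
  have h2 : ((Γ.erase c').erase c'').card + 2 = Γ.card := by
    rw [← Finset.card_erase_add_one hc'Γ, ← Finset.card_erase_add_one hc''Γ]
  -- all but at most one common column is shared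
  have h3 : Γ.card ≤ Sh.card + 1 := by
    have hsub : Γ ⊆ Sh ∪ Tr := by
      intro c hc
      simp only [hΓ, mem_filter, mem_univ, true_and] at hc
      rw [mem_union]
      by_cases hs : P.1 c = Q.1 c ∧ P.2 c = Q.2 c
      · left; simp only [hSh, mem_filter, mem_univ, true_and]; exact ⟨hc.1, hs⟩
      · right; simp only [hTr, mem_filter, mem_univ, true_and]; exact ⟨hc.1, hc.2, hs⟩
    have hTr1 : Tr.card ≤ 1 := card_tripleColumns_le_one d v ε hB hP hQ eP eQ hcP hcQ hδP hδQ
    exact (card_le_card hsub).trans ((card_union_le _ _).trans (by omega))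
  omega

/-- **FIRST HIT.**  From a column `u` deviating in `P` but not in `Q`, the cycle of `P` first meets the deviation set of `Q` at a column
`(σ_B⁻¹σ_P)^n u`, `0 < n <` period, which is not the joint successor of a shared column (its predecessor on the cycle does not deviate in
`Q`). [this cell] -/
theorem first_hit {θB θP : ℤ} {B P Q : Equiv.Perm (Fin m) × (Fin m → Fin K)}
    (hB : IsDominant d v ε θB B) (hP : IsDominant d v ε θP P) (eP : Fin m)
    (hcP : ∀ i, i ≠ eP → d (P.2 i) = d (B.2 i)) (hδP : d (B.2 eP) < d (P.2 eP)) {u c₀ : Fin m}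
    (huP : ¬ (P.1 u = B.1 u ∧ P.2 u = B.2 u)) (huQ : Q.1 u = B.1 u ∧ Q.2 u = B.2 u)
    (h₀P : ¬ (P.1 c₀ = B.1 c₀ ∧ P.2 c₀ = B.2 c₀)) (h₀Q : ¬ (Q.1 c₀ = B.1 c₀ ∧ Q.2 c₀ = B.2 c₀)) :
    ∃ n, 0 < n ∧ n < Function.minimalPeriod (B.1⁻¹ * P.1) u ∧
      ¬ (Q.1 (((B.1⁻¹ * P.1) ^ n) u) = B.1 (((B.1⁻¹ * P.1) ^ n) u) ∧ Q.2 (((B.1⁻¹ * P.1) ^ n) u) = B.2 (((B.1⁻¹ * P.1) ^ n) u)) ∧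
      (∀ t, t < n → Q.1 (((B.1⁻¹ * P.1) ^ t) u) = B.1 (((B.1⁻¹ * P.1) ^ t) u) ∧ Q.2 (((B.1⁻¹ * P.1) ^ t) u) = B.2 (((B.1⁻¹ * P.1) ^ t) u)) ∧
      (∀ w, ¬ (P.1 w = B.1 w ∧ P.2 w = B.2 w) → (P.1 w = Q.1 w ∧ P.2 w = Q.2 w) → B.1.symm (P.1 w) ≠ ((B.1⁻¹ * P.1) ^ n) u) := by
  classical
  obtain ⟨t₀, ht₀, hct₀⟩ := coord_exists d v ε hB hP eP hcP hδP huP h₀P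
  have hex : ∃ t, ¬ (Q.1 (((B.1⁻¹ * P.1) ^ t) u) = B.1 (((B.1⁻¹ * P.1) ^ t) u) ∧
      Q.2 (((B.1⁻¹ * P.1) ^ t) u) = B.2 (((B.1⁻¹ * P.1) ^ t) u)) := ⟨t₀, by rw [hct₀]; exact h₀Q⟩
  refine ⟨Nat.find hex, ?_, ?_, Nat.find_spec hex, fun t ht => ?_, ?_⟩
  · rw [Nat.pos_iff_ne_zero]
    intro h0
    have := Nat.find_spec hex
    rw [h0] at this
    exact this (by simpa using huQ)
  · exact lt_of_le_of_lt (Nat.find_min' hex (by rw [hct₀]; exact h₀Q)) ht₀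
  · have := Nat.find_min hex ht
    push Not at this
    exact this
  · intro w hwP hwsh heq
    have hpos : 0 < Nat.find hex := by
      rw [Nat.pos_iff_ne_zero]
      intro h0
      have := Nat.find_spec hex
      rw [h0] at this
      exact this (by simpa using huQ)
    obtain ⟨n', hn'⟩ : ∃ n', Nat.find hex = n' + 1 := ⟨Nat.find hex - 1, by omega⟩
    rw [hn', pow_succ_apply] at heq
    have hw : w = ((B.1⁻¹ * P.1) ^ n') u := P.1.injective (B.1.symm.injective heq)
    have hmin := Nat.find_min hex (show n' < Nat.find hex by omega)
    push Not at hmin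
    rw [← hw] at hmin
    -- `w` is shared, hence deviates in `Q`: contradiction
    exact hwP ⟨hwsh.1.trans hmin.1, hwsh.2.trans hmin.2⟩

end Contact

/-! ## 9. Entry columns: symmetry, the tail avoids the contact, the cycle total -/

section Three

open Summit.ValiantsHypothesis.ValiantsHypothesis.Theorems.MatrixDescartes.Negative
open Summit.ValiantsHypothesis.ValiantsHypothesis.Theorems.LacunarySymmetroidMatrixDescartes
open Finset

variable {m K : ℕ} (d : Fin K → ℕ) (v ε : Fin m → Fin m → Fin K → ℤ)

/-- symmetry of the «not a joint successor of a shared column» condition. [elementary] -/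
theorem entry_symm {B P Q : Equiv.Perm (Fin m) × (Fin m → Fin K)} {c : Fin m}
    (h : ∀ w, ¬ (P.1 w = B.1 w ∧ P.2 w = B.2 w) → (P.1 w = Q.1 w ∧ P.2 w = Q.2 w) → B.1.symm (P.1 w) ≠ c) :
    ∀ w, ¬ (Q.1 w = B.1 w ∧ Q.2 w = B.2 w) → (Q.1 w = P.1 w ∧ Q.2 w = P.2 w) → B.1.symm (Q.1 w) ≠ c := by
  intro w hwQ hws
  have hwP : ¬ (P.1 w = B.1 w ∧ P.2 w = B.2 w) := fun hh => hwQ ⟨hws.1.trans hh.1, hws.2.trans hh.2⟩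
  rw [hws.1]
  exact h w hwP ⟨hws.1.symm, hws.2.symm⟩

/-- **THE TAIL AVOIDS THE CONTACT.**  If `u` is the entry column of the contact of `P` and `Q` (a common column that is not the joint
successor of a shared column) and the cycle of `P` from `u` is outside the deviation set of `Q` at time `n₀ ≥ 1`, then it stays outside
until it returns to `u`: a re-entry column would be a second entry column (`entry_unique`). [this cell] -/
theorem tail_avoids {θB θP θQ : ℤ} {B P Q : Equiv.Perm (Fin m) × (Fin m → Fin K)}
    (hB : IsDominant d v ε θB B) (hP : IsDominant d v ε θP P) (hQ : IsDominant d v ε θQ Q) (eP eQ : Fin m)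
    (hcP : ∀ i, i ≠ eP → d (P.2 i) = d (B.2 i)) (hcQ : ∀ i, i ≠ eQ → d (Q.2 i) = d (B.2 i))
    (hδP : d (B.2 eP) < d (P.2 eP)) (hδQ : d (B.2 eQ) < d (Q.2 eQ)) {u : Fin m}
    (huP : ¬ (P.1 u = B.1 u ∧ P.2 u = B.2 u)) (huQ : ¬ (Q.1 u = B.1 u ∧ Q.2 u = B.2 u))
    (hentry : ∀ w, ¬ (P.1 w = B.1 w ∧ P.2 w = B.2 w) → (P.1 w = Q.1 w ∧ P.2 w = Q.2 w) → B.1.symm (P.1 w) ≠ u)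
    {n₀ : ℕ} (hn₀ : 0 < n₀)
    (hout : Q.1 (((B.1⁻¹ * P.1) ^ n₀) u) = B.1 (((B.1⁻¹ * P.1) ^ n₀) u) ∧ Q.2 (((B.1⁻¹ * P.1) ^ n₀) u) = B.2 (((B.1⁻¹ * P.1) ^ n₀) u)) :
    ∀ t, n₀ ≤ t → t < Function.minimalPeriod (B.1⁻¹ * P.1) u →
      Q.1 (((B.1⁻¹ * P.1) ^ t) u) = B.1 (((B.1⁻¹ * P.1) ^ t) u) ∧ Q.2 (((B.1⁻¹ * P.1) ^ t) u) = B.2 (((B.1⁻¹ * P.1) ^ t) u) := by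
  classical
  by_contra hcon
  push Not at hcon
  have hex : ∃ t, n₀ ≤ t ∧ t < Function.minimalPeriod (B.1⁻¹ * P.1) u ∧
      ¬ (Q.1 (((B.1⁻¹ * P.1) ^ t) u) = B.1 (((B.1⁻¹ * P.1) ^ t) u) ∧ Q.2 (((B.1⁻¹ * P.1) ^ t) u) = B.2 (((B.1⁻¹ * P.1) ^ t) u)) := by
    obtain ⟨t, h1, h2, h3⟩ := hcon
    exact ⟨t, h1, h2, fun hh => h3 hh.1 hh.2⟩
  set T := Nat.find hex with hT
  obtain ⟨hT1, hT2, hT3⟩ := Nat.find_spec hex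
  have hTn : T ≠ n₀ := fun hh => by rw [← hT, hh] at hT3; exact hT3 hout
  obtain ⟨T', hT'⟩ : ∃ T', T = T' + 1 := ⟨T - 1, by omega⟩
  have hprev : Q.1 (((B.1⁻¹ * P.1) ^ T') u) = B.1 (((B.1⁻¹ * P.1) ^ T') u) ∧
      Q.2 (((B.1⁻¹ * P.1) ^ T') u) = B.2 (((B.1⁻¹ * P.1) ^ T') u) := by
    have := Nat.find_min hex (show T' < T by omega)
    push Not at this
    exact this (by omega) (by omega)
  -- the re-entry column is an entry column
  have hentry' : ∀ w, ¬ (P.1 w = B.1 w ∧ P.2 w = B.2 w) → (P.1 w = Q.1 w ∧ P.2 w = Q.2 w) →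
      B.1.symm (P.1 w) ≠ ((B.1⁻¹ * P.1) ^ T) u := by
    intro w hwP hws heq
    rw [hT', pow_succ_apply] at heq
    have hw : w = ((B.1⁻¹ * P.1) ^ T') u := P.1.injective (B.1.symm.injective heq)
    rw [hw] at hwP hws
    exact hwP ⟨hws.1.trans hprev.1, hws.2.trans hprev.2⟩
  have hTP : ¬ (P.1 (((B.1⁻¹ * P.1) ^ T) u) = B.1 (((B.1⁻¹ * P.1) ^ T) u) ∧
      P.2 (((B.1⁻¹ * P.1) ^ T) u) = B.2 (((B.1⁻¹ * P.1) ^ T) u)) := coord_dev huP T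
  have heq := entry_unique d v ε hB hP hQ eP eQ hcP hcQ hδP hδQ (hT ▸ hTP) (hT ▸ hT3) huP huQ (hT ▸ hentry') hentry
  have h0 : ((B.1⁻¹ * P.1) ^ T) u = ((B.1⁻¹ * P.1) ^ 0) u := by rw [pow_zero, Equiv.Perm.one_apply]; exact hT ▸ heq
  have := pow_apply_injOn _ u (hT ▸ hT2) (minimalPeriod_pos _ u) h0
  omega

/-- the valuation gain of a single-token activation is carried by its cycle: summed over the coordinates below the period from any
deviating base column it is `V(P) − V(B)`, and the token column is on the cycle. [this cell] -/
theorem cycle_total {θB θP : ℤ} {B P : Equiv.Perm (Fin m) × (Fin m → Fin K)}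
    (hB : IsDominant d v ε θB B) (hP : IsDominant d v ε θP P) (eP : Fin m)
    (hcP : ∀ i, i ≠ eP → d (P.2 i) = d (B.2 i)) (hδP : d (B.2 eP) < d (P.2 eP)) {u : Fin m}
    (huP : ¬ (P.1 u = B.1 u ∧ P.2 u = B.2 u)) :
    (∑ i ∈ (Finset.Ico 0 (Function.minimalPeriod (B.1⁻¹ * P.1) u)).image (fun t => ((B.1⁻¹ * P.1) ^ t) u),
        (v (P.1 i) i (P.2 i) - v (B.1 i) i (B.2 i))) = (∑ i, v (P.1 i) i (P.2 i)) - ∑ i, v (B.1 i) i (B.2 i) ∧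
      eP ∈ (Finset.Ico 0 (Function.minimalPeriod (B.1⁻¹ * P.1) u)).image (fun t => ((B.1⁻¹ * P.1) ^ t) u) := by
  classical
  constructor
  · rw [← sum_sub_distrib]
    apply sum_subset (subset_univ _)
    intro i _ hi
    have hcell : P.1 i = B.1 i ∧ P.2 i = B.2 i := by
      by_contra h
      obtain ⟨t, ht, hct⟩ := coord_exists d v ε hB hP eP hcP hδP huP h
      exact hi (mem_image.2 ⟨t, mem_Ico.2 ⟨Nat.zero_le _, ht⟩, hct⟩)
    rw [hcell.1, hcell.2]; ring
  · obtain ⟨t, ht, hct⟩ := coord_exists d v ε hB hP eP hcP hδP huP (dev_token d eP hδP)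
    exact mem_image.2 ⟨t, mem_Ico.2 ⟨Nat.zero_le _, ht⟩, hct⟩

end Three

end SingleContact

end Summit.ValiantsHypothesis.ValiantsHypothesis.Theorems.KPlusLogSqLaw
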